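import Literature.Analysis.Convexity.DoeblinAveraging
import Mathlib.Algebra.BigOperators.Field
import HarnessLib

/-!
# One step of the Kesten–Doeblin ratio contraction (proved)

Topic `Literature/Analysis/Convexity`. Companion of `DoeblinAveraging.lean`: the purely arithmetic
content of one level of Kesten's ratio-limit argument (H. Kesten, PTRF 73 (1986), proof of Thm. 3;
the "coupling property" of Garban–Pete–Schramm, JAMS 26 (2013), Prop. 3.1/11, in ratio form).
Two "outer data" `1, 2` each decompose a numerator `N` and a denominator `M` over the same finite
family of "inner data" `k` with the SAME inner factors `gx k, gx' k > 0` (ratios `r k = gx k / gx' k ∈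
[A, B]`), outer-dependent nonnegative weights `tᵢ k`, and nonnegative junk terms of relative size `≤ ε`:

  `Nᵢ = ∑ₖ tᵢ k · gx k + eᵢ`,  `Mᵢ = ∑ₖ tᵢ k · gx' k + eᵢ'`,  `eᵢ ≤ ε Nᵢ`, `eᵢ' ≤ ε Mᵢ`.

If the normalised weight vectors `k ↦ tᵢ k · gx' k / ∑ⱼ tᵢ j · gx' j` both dominate `β ν` for a common
probability vector `ν` (overlap `β`), then (`ratio_div_ratio_le_of_overlap`)

  `N₁ / M₁ ≤ (β + (1 - β) B / A) / (1 - ε)² · (N₂ / M₂)`,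

i.e. the ratio of the two outer ratios exceeds `1` by at most `(1 - β)(B/A - 1)` up to the junk factor
`(1 - ε)⁻²`. In Kesten's setting `Nᵢ, Mᵢ` are the probabilities that the anchors `x, x'` are joined to
the outer circuit `i`, `k` runs over the next outermost open circuit inside, `tᵢ k` is the probability
(under the measure enclosed by `i`) that `k` occurs and is joined to `i`, `gx k` the probability inside
`k` (wired) that `x` is joined to `k`, and the junk is the event that no circuit occurs in the block
(`≤ (1-c)^m` of the total by RSW and FKG). Everything is proved; no definitions.

## References

* H. Kesten, *The incipient infinite cluster in two-dimensional percolation*, Probab. Theory Related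
  Fields 73 (1986) 369–394, proof of Thm. 3.
-/

open Finset

namespace Literature.Analysis.Convexity.Doeblin

variable {κ : Type*}

/-- **The clean part of a decomposed quantity controls it up to `(1-ε)⁻¹`.** If `N = P + e` with
`0 ≤ e ≤ ε N` and `ε < 1`, then `P ≤ N` and `N ≤ P / (1 - ε)`. [cite: Kesten1986, proof of Thm. 3] -/
theorem le_and_le_div_of_junk {N P e ε : ℝ} (hN : N = P + e) (he0 : 0 ≤ e) (he : e ≤ ε * N)
    (hε1 : ε < 1) : P ≤ N ∧ N ≤ P / (1 - ε) := by
  have h1 : 0 < 1 - ε := sub_pos.2 hε1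
  refine ⟨by linarith, ?_⟩
  rw [le_div_iff₀ h1]
  nlinarith

/-- **One step of the Kesten–Doeblin ratio contraction.** See the module docstring: with common
inner factors `gx, gx' > 0` of ratios in `[A, B]` (`0 < A`), outer weights `t₁, t₂ ≥ 0` with positive
clean denominators, junk of relative size `≤ ε`, `ε < 1`, and overlap `β ∈ [0,1]` of the two normalised
weight vectors on a probability vector `ν ≥ 0`,
`N₁ / M₁ ≤ (β + (1 - β) · B / A) / (1 - ε)² · (N₂ / M₂)`. [cite: Kesten1986, proof of Thm. 3] -/
theorem ratio_div_ratio_le_of_overlap (s : Finset κ) (gx gx' t₁ t₂ ν : κ → ℝ)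
    {A B β ε N₁ M₁ N₂ M₂ e₁ e₁' e₂ e₂' : ℝ}
    (hgx' : ∀ k ∈ s, 0 < gx' k) (hA : 0 < A)
    (hr : ∀ k ∈ s, A ≤ gx k / gx' k ∧ gx k / gx' k ≤ B)
    (ht₁ : ∀ k ∈ s, 0 ≤ t₁ k) (ht₂ : ∀ k ∈ s, 0 ≤ t₂ k)
    (hS₁ : 0 < ∑ k ∈ s, t₁ k * gx' k) (hS₂ : 0 < ∑ k ∈ s, t₂ k * gx' k)
    (hν0 : ∀ k ∈ s, 0 ≤ ν k) (hν1 : ∑ k ∈ s, ν k = 1) (hβ0 : 0 ≤ β) (hβ1 : β ≤ 1)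
    (hov₁ : ∀ k ∈ s, β * ν k * (∑ j ∈ s, t₁ j * gx' j) ≤ t₁ k * gx' k)
    (hov₂ : ∀ k ∈ s, β * ν k * (∑ j ∈ s, t₂ j * gx' j) ≤ t₂ k * gx' k)
    (hε1 : ε < 1)
    (hN₁ : N₁ = ∑ k ∈ s, t₁ k * gx k + e₁) (hM₁ : M₁ = ∑ k ∈ s, t₁ k * gx' k + e₁')
    (hN₂ : N₂ = ∑ k ∈ s, t₂ k * gx k + e₂) (hM₂ : M₂ = ∑ k ∈ s, t₂ k * gx' k + e₂')
    (he₁ : 0 ≤ e₁ ∧ e₁ ≤ ε * N₁) (he₁' : 0 ≤ e₁' ∧ e₁' ≤ ε * M₁)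
    (he₂ : 0 ≤ e₂ ∧ e₂ ≤ ε * N₂) (he₂' : 0 ≤ e₂' ∧ e₂' ≤ ε * M₂) :
    N₁ / M₁ ≤ (β + (1 - β) * B / A) / (1 - ε) ^ 2 * (N₂ / M₂) := by
  have h1ε : 0 < 1 - ε := sub_pos.2 hε1
  -- clean parts as weighted averages of the ratios
  set S₁ := ∑ k ∈ s, t₁ k * gx' k with hS₁def
  set S₂ := ∑ k ∈ s, t₂ k * gx' k with hS₂def
  set P₁ := ∑ k ∈ s, t₁ k * gx k with hP₁def
  set P₂ := ∑ k ∈ s, t₂ k * gx k with hP₂def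
  set r : κ → ℝ := fun k => gx k / gx' k with hrdef
  set w₁ : κ → ℝ := fun k => t₁ k * gx' k / S₁ with hw₁def
  set w₂ : κ → ℝ := fun k => t₂ k * gx' k / S₂ with hw₂def
  have hP₁eq : P₁ = S₁ * ∑ k ∈ s, w₁ k * r k := by
    rw [hP₁def, Finset.mul_sum]
    refine Finset.sum_congr rfl fun k hk => ?_
    simp only [hw₁def, hrdef]
    field_simp [(hgx' k hk).ne', hS₁.ne']
  have hP₂eq : P₂ = S₂ * ∑ k ∈ s, w₂ k * r k := by
    rw [hP₂def, Finset.mul_sum]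
    refine Finset.sum_congr rfl fun k hk => ?_
    simp only [hw₂def, hrdef]
    field_simp [(hgx' k hk).ne', hS₂.ne']
  have hw₁1 : ∑ k ∈ s, w₁ k = 1 := by
    simp only [hw₁def]
    rw [← Finset.sum_div, div_self hS₁.ne']
  have hw₂1 : ∑ k ∈ s, w₂ k = 1 := by
    simp only [hw₂def]
    rw [← Finset.sum_div, div_self hS₂.ne']
  have hdom₁ : ∀ k ∈ s, β * ν k ≤ w₁ k := fun k hk => by
    simp only [hw₁def]
    rw [le_div_iff₀ hS₁]
    exact hov₁ k hk
  have hdom₂ : ∀ k ∈ s, β * ν k ≤ w₂ k := fun k hk => by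
    simp only [hw₂def]
    rw [le_div_iff₀ hS₂]
    exact hov₂ k hk
  -- Doeblin's contraction for the two averages
  have hD := sum_mul_le_mul_sum_mul_of_overlap s w₁ w₂ ν r hw₁1 hw₂1 hν0 hν1 hβ0 hβ1 hdom₁ hdom₂ hA hr
  set avg₁ := ∑ k ∈ s, w₁ k * r k with havg₁
  set avg₂ := ∑ k ∈ s, w₂ k * r k with havg₂
  set C := β + (1 - β) * B / A with hC
  -- positivity of the averages and of the constant
  have hAB : A ≤ B := by
    have hs : s.Nonempty := by
      by_contra hs'
      rw [Finset.not_nonempty_iff_eq_empty] at hs'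
      rw [hs', Finset.sum_empty] at hν1
      exact zero_ne_one hν1
    obtain ⟨i, hi⟩ := hs
    exact (hr i hi).1.trans (hr i hi).2
  have hB : 0 < B := hA.trans_le hAB
  have hC0 : 0 ≤ C := by
    have : 0 ≤ (1 - β) * B / A := div_nonneg (mul_nonneg (sub_nonneg.2 hβ1) hB.le) hA.le
    simp only [hC]; linarith
  have hw₂0 : ∀ k ∈ s, 0 ≤ w₂ k := fun k hk => by
    simp only [hw₂def]; exact div_nonneg (mul_nonneg (ht₂ k hk) (hgx' k hk).le) hS₂.le
  have havg₂pos : 0 < avg₂ := by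
    have : A ≤ avg₂ := by
      calc A = ∑ k ∈ s, w₂ k * A := by rw [← Finset.sum_mul, hw₂1, one_mul]
        _ ≤ avg₂ := Finset.sum_le_sum fun k hk => mul_le_mul_of_nonneg_left (hr k hk).1 (hw₂0 k hk)
    exact hA.trans_le this
  -- junk control
  obtain ⟨hP₁N₁, hN₁le⟩ := le_and_le_div_of_junk hN₁ he₁.1 he₁.2 hε1
  obtain ⟨hS₁M₁, -⟩ := le_and_le_div_of_junk hM₁ he₁'.1 he₁'.2 hε1
  obtain ⟨hP₂N₂, -⟩ := le_and_le_div_of_junk hN₂ he₂.1 he₂.2 hε1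
  obtain ⟨hS₂M₂, hM₂le⟩ := le_and_le_div_of_junk hM₂ he₂'.1 he₂'.2 hε1
  have hM₁pos : 0 < M₁ := hS₁.trans_le hS₁M₁
  have hM₂pos : 0 < M₂ := hS₂.trans_le hS₂M₂
  have hP₂pos : 0 < P₂ := by rw [hP₂eq]; exact mul_pos hS₂ havg₂pos
  have hN₂pos : 0 < N₂ := hP₂pos.trans_le hP₂N₂
  -- upper bound for the first ratio: `N₁/M₁ ≤ avg₁ / (1-ε)`
  have hup : N₁ / M₁ ≤ avg₁ / (1 - ε) := by
    have h1 : N₁ / M₁ ≤ N₁ / S₁ := by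
      apply div_le_div_of_nonneg_left _ hS₁ hS₁M₁
      exact hP₁N₁.trans' (by rw [hP₁eq]; exact mul_nonneg hS₁.le (by
        have : A ≤ avg₁ := by
          have hw₁0 : ∀ k ∈ s, 0 ≤ w₁ k := fun k hk => by
            simp only [hw₁def]; exact div_nonneg (mul_nonneg (ht₁ k hk) (hgx' k hk).le) hS₁.le
          calc A = ∑ k ∈ s, w₁ k * A := by rw [← Finset.sum_mul, hw₁1, one_mul]
            _ ≤ avg₁ := Finset.sum_le_sum fun k hk => mul_le_mul_of_nonneg_left (hr k hk).1 (hw₁0 k hk)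
        exact hA.le.trans this))
    have h2 : N₁ / S₁ ≤ (P₁ / (1 - ε)) / S₁ := div_le_div_of_nonneg_right hN₁le hS₁.le
    have h3 : (P₁ / (1 - ε)) / S₁ = avg₁ / (1 - ε) := by
      rw [hP₁eq]; field_simp
    linarith [h3 ▸ h2]
  -- lower bound for the second ratio: `(1-ε) avg₂ ≤ N₂/M₂`
  have hlo : (1 - ε) * avg₂ ≤ N₂ / M₂ := by
    rw [le_div_iff₀ hM₂pos]
    calc (1 - ε) * avg₂ * M₂ ≤ (1 - ε) * avg₂ * (S₂ / (1 - ε)) :=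
          mul_le_mul_of_nonneg_left hM₂le (mul_nonneg h1ε.le havg₂pos.le)
      _ = S₂ * avg₂ := by field_simp
      _ = P₂ := hP₂eq.symm
      _ ≤ N₂ := hP₂N₂
  -- assemble
  have hε2 : 0 < (1 - ε) ^ 2 := pow_pos h1ε 2
  calc N₁ / M₁ ≤ avg₁ / (1 - ε) := hup
    _ ≤ C * avg₂ / (1 - ε) := div_le_div_of_nonneg_right hD h1ε.le
    _ = C / (1 - ε) ^ 2 * ((1 - ε) * avg₂) := by field_simp
    _ ≤ C / (1 - ε) ^ 2 * (N₂ / M₂) :=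
        mul_le_mul_of_nonneg_left hlo (div_nonneg hC0 hε2.le)

end Literature.Analysis.Convexity.Doeblin
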